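import Literature.Probability.Percolation.BoundaryConnectivity
import Literature.Probability.Percolation.SiteCrossingDuality
import Literature.Probability.LatticeModels.ZhangCrossing
import HarnessLib

/-!
# The onion dichotomy in a hole-free domain (Georgii–Higuchi 2000, proof of Lemma 2.3, claim (1))

Topic `Probability/Percolation`. The deterministic combinatorial core of the point-to-semicircuit
lemma (Georgii–Higuchi, J. Math. Phys. 41 (2000), Lemma 2.3): in the proof, GH show that for every
configuration of a symmetric domain `Λ` with `+` boundary condition on the upper boundary arc `σ`
and `-` on its mirror image, "`μ^ω_Λ(D ∪ R∘T(D)) = 1`", by the **onion argument**: "suppose that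
`ω(x) = +1` but `B` does not occur. Then the `+∗`cluster containing `x` does not meet `σ`. Its outer
boundary belongs to a `-∗`cluster, which either touches `R(σ)` … or not — in which case we
consider the `+∗`cluster containing its outer boundary, and so on."

We prove this dichotomy for a finite hole-free domain `Λ ⊆ ℤ²` and a colouring `c` which, outside
`Λ`, is `+1` on and above the horizontal axis and `-1` below it (the boundary condition `η±`),
in a circuit-free formulation:

* `kSet Λ c s` — the `s`-sites of `Λ` joined by an `s∗`-path inside `Λ` to a site `∗`-adjacent to
  the outside region on the `s`-side (`x₂ ≥ 0` for `s = +1`, `x₂ ≤ 0` for `s = -1`); the events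
  `B = {x ∈ kSet … 1}` and `R∘T(B) = {x ∈ kSet … (-1)}`;
* `xSet Λ c s` — the sites of `Λ ∖ kSet s` that can be reached, inside `Λ` and avoiding `kSet s`,
  from a site `∗`-adjacent to the outside region strictly on the other side; the event `C` of GH
  is `{x ∉ xSet … 1}` (then the complement of the explored region is a volume containing `x` all of
  whose `∗`-neighbours are `+`), and `R∘T(C) = {x ∉ xSet … (-1)}`;
* **`onion_dichotomy`** — `x ∈ kSet 1 ∨ x ∈ kSet (-1) ∨ x ∉ xSet 1 ∨ x ∉ xSet (-1)`.

The proof follows GH: starting from the cluster of `x`, the outer `∗`-boundary of a finite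
`∗`-cluster is `∗`-connected (`exists_starWalk_starBoundary`, `BoundaryConnectivity`) and of the
opposite colour, hence lies in one cluster of the opposite colour; if that cluster touches the
outside (or the corresponding `kSet`) we get a contradiction with the reachability defining
`xSet`, otherwise we iterate; "outer" is formalised by `FarRight` (joined to arbitrarily far points
avoiding the set), and termination by the number of sites of `Λ` outside the current onion.

## References

* H.-O. Georgii, Y. Higuchi, J. Math. Phys. 41 (2000), Lemma 2.3 and its proof (pp. 5–6)
  [GeorgiiHiguchi2000].
* H. Kesten, *Percolation theory for mathematicians*, Birkhäuser 1982, §2.2 [Kesten1982].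
-/

noncomputable section

open SimpleGraph Finset
open Literature.Probability.LatticeModels (Site zdGraph zdStarGraph zdGraph_adj_iff zdStarGraph_adj
  zdGraph_le_zdStarGraph zdGraph_reachable)

namespace Literature.Probability.Percolation

/-! ### Reaching far to the right -/

section Far

/-- `z` is joined to points arbitrarily far to the right by `∗`-walks avoiding `A` (for finite `A`:
`z` lies in the unbounded `∗`-component of the complement). [folklore] -/
def FarRight (A : Set (Site 2)) (z : Site 2) : Prop :=
  ∀ M : ℤ, ∃ w : Site 2, M ≤ w 0 ∧ ∃ p : zdStarGraph.Walk z w, ∀ v ∈ p.support, v ∉ A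

variable {A A' : Set (Site 2)} {z z' : Site 2}

/-- A far-reaching site is not in the set. [folklore] -/
theorem FarRight.not_mem (h : FarRight A z) : z ∉ A := by
  obtain ⟨w, -, p, hp⟩ := h 0
  exact hp z (Walk.start_mem_support p)

/-- Prepending a step. [folklore] -/
theorem FarRight.of_adj (h : FarRight A z) (hadj : zdStarGraph.Adj z' z) (hz' : z' ∉ A) : FarRight A z' := by
  intro M
  obtain ⟨w, hw, p, hp⟩ := h M
  refine ⟨w, hw, Walk.cons hadj p, fun v hv => ?_⟩
  rw [Walk.support_cons, List.mem_cons] at hv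
  rcases hv with rfl | hv
  · exact hz'
  · exact hp v hv

/-- Monotonicity in the avoided set. [folklore] -/
theorem FarRight.mono (hA : A' ⊆ A) (h : FarRight A z) : FarRight A' z := by
  intro M
  obtain ⟨w, hw, p, hp⟩ := h M
  exact ⟨w, hw, p, fun v hv hv' => hp v hv (hA hv')⟩

/-- **The first far-reaching site on a walk is `∗`-adjacent to the set.** [folklore] -/
theorem exists_farRight_adj_of_walk :
    ∀ {a b : Site 2} (p : zdStarGraph.Walk a b), ¬ FarRight A a → FarRight A b →
      ∃ v ∈ p.support, FarRight A v ∧ ∃ u ∈ A, zdStarGraph.Adj u v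
  | _, _, Walk.nil, ha, hb => absurd hb ha
  | a, b, Walk.cons (v := a') hadj p', ha, hb => by
    by_cases ha' : FarRight A a'
    · have haA : a ∈ A := by
        by_contra h
        exact ha (ha'.of_adj hadj h)
      exact ⟨a', by simp, ha', a, haA, hadj⟩
    · obtain ⟨v, hv, h1, h2⟩ := exists_farRight_adj_of_walk p' ha' hb
      exact ⟨v, by rw [Walk.support_cons]; exact List.mem_cons_of_mem _ hv, h1, h2⟩

/-- A `∗`-walk between two sites with the same large first coordinate... more generally between
any two sites to the right of a vertical line, staying to the right of it. [folklore] -/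
theorem exists_walk_right_of {w₁ w₂ : Site 2} {M : ℤ} (h₁ : M ≤ w₁ 0) (h₂ : M ≤ w₂ 0) :
    ∃ p : zdStarGraph.Walk w₁ w₂, ∀ v ∈ p.support, M ≤ v 0 := by
  -- horizontal runs to the common column `max`, then a vertical run
  have hright : ∀ (w : Site 2) (k : ℕ), ∃ p : zdStarGraph.Walk w ((fun u : Site 2 => u + Pi.single 0 1)^[k] w),
      ∀ v ∈ p.support, w 0 ≤ v 0 := by
    intro w k
    refine ⟨(LatticeModels.Zhang.stepRun (Pi.single 0 1) LatticeModels.Zhang.adj_add_unitStep.1 w k).mapLe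
      zdGraph_le_zdStarGraph, fun v hv => ?_⟩
    rw [Walk.support_mapLe_eq_support, LatticeModels.Zhang.mem_support_stepRun] at hv
    obtain ⟨j, -, h0, -⟩ := hv
    simp at h0; omega
  have hvert : ∀ (w w' : Site 2), w 0 = w' 0 → ∃ p : zdStarGraph.Walk w w', ∀ v ∈ p.support, v 0 = w 0 := by
    intro w w' h
    rcases le_or_gt (w 1) (w' 1) with hle | hlt
    · obtain ⟨k, hk⟩ : ∃ k : ℕ, w' 1 = w 1 + k := ⟨(w' 1 - w 1).toNat, by omega⟩
      have hend : (fun u : Site 2 => u + Pi.single 1 1)^[k] w = w' := by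
        ext i; rw [LatticeModels.Zhang.iterate_add_apply]; fin_cases i <;> simp <;> omega
      refine ⟨((LatticeModels.Zhang.stepRun (Pi.single 1 1) LatticeModels.Zhang.adj_add_unitStep.2.2.1 w k).mapLe
        zdGraph_le_zdStarGraph).copy rfl hend, fun v hv => ?_⟩
      rw [Walk.support_copy, Walk.support_mapLe_eq_support, LatticeModels.Zhang.mem_support_stepRun] at hv
      obtain ⟨j, -, h0, -⟩ := hv
      simpa using h0
    · obtain ⟨k, hk⟩ : ∃ k : ℕ, w 1 = w' 1 + k := ⟨(w 1 - w' 1).toNat, by omega⟩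
      have hend : (fun u : Site 2 => u + -Pi.single 1 1)^[k] w = w' := by
        ext i; rw [LatticeModels.Zhang.iterate_add_apply]; fin_cases i <;> simp <;> omega
      refine ⟨((LatticeModels.Zhang.stepRun (-Pi.single 1 1) LatticeModels.Zhang.adj_add_unitStep.2.2.2 w k).mapLe
        zdGraph_le_zdStarGraph).copy rfl hend, fun v hv => ?_⟩
      rw [Walk.support_copy, Walk.support_mapLe_eq_support, LatticeModels.Zhang.mem_support_stepRun] at hv
      obtain ⟨j, -, h0, -⟩ := hv
      simpa using h0
  -- move both to the column `C = max (w₁ 0) (w₂ 0)`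
  set C := max (w₁ 0) (w₂ 0) with hC
  obtain ⟨k₁, hk₁⟩ : ∃ k : ℕ, C = w₁ 0 + k := ⟨(C - w₁ 0).toNat, by omega⟩
  obtain ⟨k₂, hk₂⟩ : ∃ k : ℕ, C = w₂ 0 + k := ⟨(C - w₂ 0).toNat, by omega⟩
  obtain ⟨p₁, hp₁⟩ := hright w₁ k₁
  obtain ⟨p₂, hp₂⟩ := hright w₂ k₂
  have e₁ : ((fun u : Site 2 => u + Pi.single 0 1)^[k₁] w₁) 0 = C := by
    rw [LatticeModels.Zhang.iterate_add_apply]; simp; omega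
  have e₂ : ((fun u : Site 2 => u + Pi.single 0 1)^[k₂] w₂) 0 = C := by
    rw [LatticeModels.Zhang.iterate_add_apply]; simp; omega
  obtain ⟨q, hq⟩ := hvert _ _ (e₁.trans e₂.symm)
  refine ⟨p₁.append (q.append p₂.reverse), fun v hv => ?_⟩
  rw [Walk.mem_support_append_iff, Walk.mem_support_append_iff, Walk.support_reverse, List.mem_reverse] at hv
  rcases hv with hv | hv | hv
  · exact h₁.trans (hp₁ v hv)
  · rw [hq v hv, e₁]; exact le_max_of_le_left h₁
  · exact h₂.trans (hp₂ v hv)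

/-- A column to the right of a finite set. [folklore] -/
theorem exists_column_gt (A : Finset (Site 2)) : ∃ M : ℤ, ∀ a ∈ A, a 0 < M := by
  refine ⟨((A.sup fun a => (a 0).toNat : ℕ) : ℤ) + 1, fun a ha => ?_⟩
  have h1 : (a 0).toNat ≤ A.sup fun a => (a 0).toNat := Finset.le_sup (f := fun a : Site 2 => (a 0).toNat) ha
  have h2 : a 0 ≤ (a 0).toNat := Int.self_le_toNat _
  omega

/-- **Two far-reaching sites are joined avoiding a finite set.** [folklore] -/
theorem exists_walk_of_farRight (A : Finset (Site 2)) {d t : Site 2} (hd : FarRight ↑A d) (ht : FarRight ↑A t) :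
    ∃ q : zdStarGraph.Walk d t, ∀ v ∈ q.support, v ∉ A := by
  obtain ⟨M, hM⟩ := exists_column_gt A
  obtain ⟨w₁, hw₁, p₁, hp₁⟩ := hd M
  obtain ⟨w₂, hw₂, p₂, hp₂⟩ := ht M
  obtain ⟨q, hq⟩ := exists_walk_right_of hw₁ hw₂
  refine ⟨p₁.append (q.append p₂.reverse), fun v hv => ?_⟩
  rw [Walk.mem_support_append_iff, Walk.mem_support_append_iff, Walk.support_reverse, List.mem_reverse] at hv
  rcases hv with hv | hv | hv
  · exact hp₁ v hv
  · intro hvA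
    have := hM v hvA
    have := hq v hv
    omega
  · exact hp₂ v hv

/-- Sites far to the right of a finite set reach far. [folklore] -/
theorem farRight_of_gt (A : Finset (Site 2)) {M : ℤ} (hM : ∀ a ∈ A, a 0 < M) {z : Site 2} (hz : M ≤ z 0) :
    FarRight ↑A z := by
  intro M'
  obtain ⟨k, hk⟩ : ∃ k : ℕ, max M' (z 0) ≤ z 0 + k := ⟨(max M' (z 0) - z 0).toNat, by omega⟩
  set w := (fun u : Site 2 => u + Pi.single 0 1)^[k] z with hw
  have hw0 : w 0 = z 0 + k := by rw [hw, LatticeModels.Zhang.iterate_add_apply]; simp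
  obtain ⟨p, hp⟩ := exists_walk_right_of (w₁ := z) (w₂ := w) le_rfl (by omega)
  refine ⟨w, by omega, p, fun v hv hvA => ?_⟩
  have := hM v hvA; have := hp v hv; omega

/-- Far-reaching propagates along a walk avoiding the set. [folklore] -/
theorem farRight_of_walk_avoiding {A : Set (Site 2)} :
    ∀ {a b : Site 2} (p : zdStarGraph.Walk a b), FarRight A a → (∀ v ∈ p.support, v ∉ A) →
      ∀ v ∈ p.support, FarRight A v
  | _, _, Walk.nil, ha, _, v, hv => by
    rw [Walk.support_nil, List.mem_singleton] at hv; exact hv ▸ ha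
  | a, _, Walk.cons (v := a') hadj p', ha, hp, v, hv => by
    rw [Walk.support_cons, List.mem_cons] at hv
    rcases hv with rfl | hv
    · exact ha
    · have ha' : FarRight A a' := ha.of_adj hadj.symm (hp a' (by simp))
      exact farRight_of_walk_avoiding p' ha' (fun w hw => hp w (by rw [Walk.support_cons]; exact List.mem_cons_of_mem _ hw)) v hv

end Far

/-! ### The onion dichotomy -/

section Onion

variable (Λ : Finset (Site 2)) (c : Site 2 → ℤˣ)

/-- The side condition for the witnesses of `kSet`: `x₂ ≥ 0` for `s = +1`, `x₂ ≤ 0` for `s = -1`. [cite: GeorgiiHiguchi2000, Lemma 2.3 (proof)] -/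
def OnSide (s : ℤˣ) (z : Site 2) : Prop := 0 ≤ (s : ℤ) * z 1

/-- The `s∗`-connection graph inside `Λ`. [cite: GeorgiiHiguchi2000, Lemma 2.3 (proof)] -/
def sGraph (s : ℤˣ) : SimpleGraph (Site 2) := siteOpenGraph zdStarGraph ({v | c v = s} ∩ ↑Λ)

/-- **`kSet s`**: the `s`-sites of `Λ` joined by an `s∗`-path inside `Λ` to a site `∗`-adjacent to
the outside on the `s`-side (GH's event `B` is `x ∈ kSet 1`, its flip-reflection `x ∈ kSet (-1)`). [cite: GeorgiiHiguchi2000, Lemma 2.3 (proof)] -/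
def kSet (s : ℤˣ) : Set (Site 2) :=
  {p | p ∈ Λ ∧ c p = s ∧ ∃ q, (∃ z, z ∉ Λ ∧ OnSide s z ∧ zdStarGraph.Adj q z) ∧ (sGraph Λ c s).Reachable p q}

/-- **`xSet s`**: the sites of `Λ ∖ kSet s` reachable inside `Λ ∖ kSet s` from a site `∗`-adjacent
to the outside strictly on the other side (GH's event `C` is `x ∉ xSet 1`). [cite: GeorgiiHiguchi2000, Lemma 2.3 (proof)] -/
def xSet (s : ℤˣ) : Set (Site 2) :=
  {p | p ∈ Λ ∧ p ∉ kSet Λ c s ∧ ∃ q, (∃ z, z ∉ Λ ∧ ¬ OnSide s z ∧ zdStarGraph.Adj q z) ∧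
    (siteOpenGraph zdStarGraph (↑Λ \ kSet Λ c s)).Reachable p q}

variable {Λ c}

/-- Closure of `kSet` under `s∗`-connection inside `Λ`. [folklore] -/
theorem mem_kSet_of_reachable {s : ℤˣ} {p q : Site 2} (hp : p ∈ kSet Λ c s) (hq : q ∈ Λ) (hcq : c q = s)
    (hr : (sGraph Λ c s).Reachable q p) : q ∈ kSet Λ c s := by
  obtain ⟨-, -, r, hr', hpr⟩ := hp
  exact ⟨hq, hcq, r, hr', hr.trans hpr⟩

/-- Witnesses belong to `kSet`. [folklore] -/
theorem mem_kSet_of_adj {s : ℤˣ} {q z : Site 2} (hq : q ∈ Λ) (hcq : c q = s) (hz : z ∉ Λ) (hside : OnSide s z)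
    (hadj : zdStarGraph.Adj q z) : q ∈ kSet Λ c s :=
  ⟨hq, hcq, q, ⟨z, hz, hside, hadj⟩, Reachable.refl _⟩

/-- A unit is `1` or `-1`; the other one. [folklore] -/
theorem units_eq_neg_of_ne {u s : ℤˣ} (h : u ≠ s) : u = -s := by
  rcases Int.units_eq_one_or u with rfl | rfl <;> rcases Int.units_eq_one_or s with rfl | rfl <;> simp at h ⊢

section Colours

variable (hcpos : ∀ z ∉ Λ, 0 ≤ z 1 → c z = 1) (hcneg : ∀ z ∉ Λ, z 1 < 0 → c z = -1)
include hcpos hcneg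

/-- Outside `s`-coloured sites are on the `s`-side. [folklore] -/
theorem onSide_of_colour {s : ℤˣ} {z : Site 2} (hz : z ∉ Λ) (hcz : c z = s) : OnSide s z := by
  unfold OnSide
  rcases Int.units_eq_one_or s with rfl | rfl
  · by_contra h
    have : z 1 < 0 := by push Not at h; simpa using h
    rw [hcneg z hz this] at hcz; exact absurd hcz (by decide)
  · by_contra h
    have : 0 ≤ z 1 := by push Not at h; simp at h; omega
    rw [hcpos z hz this] at hcz; exact absurd hcz (by decide)

/-- Outside sites not on the `s`-side have colour `-s`. [folklore] -/
theorem colour_of_not_onSide {s : ℤˣ} {z : Site 2} (hz : z ∉ Λ) (h : ¬ OnSide s z) : c z = -s := by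
  unfold OnSide at h
  rcases Int.units_eq_one_or s with rfl | rfl
  · have : z 1 < 0 := by push Not at h; simpa using h
    simpa using hcneg z hz this
  · have : 0 ≤ z 1 := by push Not at h; simp at h; omega
    simpa using hcpos z hz this

end Colours

/-- From reachability in an open site graph: a `∗`-walk with support in the open set. [folklore] -/
theorem exists_starWalk_of_reachable {O : Set (Site 2)} {a b : Site 2} (h : (siteOpenGraph zdStarGraph O).Reachable a b)
    (ha : a ∈ O) : ∃ w : zdStarGraph.Walk a b, ∀ z ∈ w.support, z ∈ O := by
  obtain ⟨p⟩ := h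
  refine ⟨p.mapLe (fun u v huv => ((siteOpenGraph_adj _ _ _ _).1 huv).1), fun z hz => ?_⟩
  rw [Walk.support_mapLe_eq_support] at hz
  exact support_subset_of_siteOpenGraph_walk p ha z hz

/-- Sites on an open walk are reachable from its start in the open graph. [folklore] -/
theorem reachable_of_mem_support_open {O : Set (Site 2)} {a b : Site 2} (p : (siteOpenGraph zdStarGraph O).Walk a b)
    {z : Site 2} (hz : z ∈ p.support) : (siteOpenGraph zdStarGraph O).Reachable a z :=
  ⟨p.takeUntil z hz⟩

/-- **The onion dichotomy** (Georgii–Higuchi 2000, proof of Lemma 2.3, claim (1), deterministic form):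
for a finite hole-free domain `Λ` and a colouring equal to `η±` outside `Λ`, every site `x ∈ Λ`
satisfies `B⁺ ∨ B⁻ ∨ C⁺ ∨ C⁻`. [cite: GeorgiiHiguchi2000, Lemma 2.3 (proof, claim (1))] -/
theorem onion_dichotomy (hHF : ∀ z ∉ Λ, FarRight ↑Λ z) (hcpos : ∀ z ∉ Λ, 0 ≤ z 1 → c z = 1)
    (hcneg : ∀ z ∉ Λ, z 1 < 0 → c z = -1) {x : Site 2} (hx : x ∈ Λ) :
    x ∈ kSet Λ c 1 ∨ x ∈ kSet Λ c (-1) ∨ x ∉ xSet Λ c 1 ∨ x ∉ xSet Λ c (-1) := by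
  classical
  by_contra H
  push Not at H
  obtain ⟨hK1, hK2, hX1, hX2⟩ := H
  have hK : ∀ s : ℤˣ, x ∉ kSet Λ c s := fun s => by
    rcases Int.units_eq_one_or s with rfl | rfl
    · exact hK1
    · exact hK2
  have hX : ∀ s : ℤˣ, x ∈ xSet Λ c s := fun s => by
    rcases Int.units_eq_one_or s with rfl | rfl
    · exact hX1
    · exact hX2
  obtain ⟨M, hM⟩ := exists_column_gt Λ
  have hfar_out : ∀ z, z ∉ Λ → ∀ (Q : Finset (Site 2)), Q ⊆ Λ → FarRight ↑Q z := fun z hz Q hQ =>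
    (hHF z hz).mono (Finset.coe_subset.2 hQ)
  -- the onion step, with the induction hypothesis as a parameter
  have step : ∀ (s : ℤˣ) (Q : Finset (Site 2)), Q ⊆ Λ → (∀ q ∈ Q, c q = s) → Q.Nonempty →
      (∀ q ∈ Q, ∀ p ∈ Λ, c p = s → zdStarGraph.Adj q p → p ∈ Q) →
      (∀ a ∈ Q, ∀ b ∈ Q, ∃ w : zdStarGraph.Walk a b, ∀ z ∈ w.support, z ∈ Q) →
      (∀ q ∈ Q, q ∉ kSet Λ c s) → ¬ FarRight ↑Q x →
      (∀ (s' : ℤˣ) (Q' : Finset (Site 2)),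
        #(Λ.filter fun v => FarRight ↑Q' v) < #(Λ.filter fun v => FarRight ↑Q v) →
        Q' ⊆ Λ → (∀ q ∈ Q', c q = s') → Q'.Nonempty →
        (∀ q ∈ Q', ∀ p ∈ Λ, c p = s' → zdStarGraph.Adj q p → p ∈ Q') →
        (∀ a ∈ Q', ∀ b ∈ Q', ∃ w : zdStarGraph.Walk a b, ∀ z ∈ w.support, z ∈ Q') →
        (∀ q ∈ Q', q ∉ kSet Λ c s') → ¬ FarRight ↑Q' x → False) → False := by
    intro s Q hQΛ hQc hQne hQcl hQconn hQK hQx IH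
    -- the outer boundary `D`
    set D : Set (Site 2) := {v | FarRight ↑Q v ∧ ∃ q ∈ Q, zdStarGraph.Adj q v} with hD
    -- (D2) colours
    have hDcol : ∀ v ∈ D, c v = -s := by
      rintro v ⟨hvfar, q, hq, hqv⟩
      by_cases hvΛ : v ∈ Λ
      · refine units_eq_neg_of_ne fun hcv => hvfar.not_mem ?_
        exact Finset.mem_coe.2 (hQcl q hq v hvΛ hcv hqv)
      · refine colour_of_not_onSide hcpos hcneg hvΛ fun hside => hQK q hq ?_
        exact mem_kSet_of_adj (hQΛ hq) (hQc q hq) hvΛ hside hqv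
    -- (D1) nonempty
    obtain ⟨q₀, hq₀⟩ := hQne
    have hDne : ∃ d, d ∈ D := by
      set z : Site 2 := ![M, 0] with hz
      have hzΛ : z ∉ Λ := fun h => by have := hM z h; simp [hz] at this
      have hzfar : FarRight ↑Q z := hfar_out z hzΛ Q hQΛ
      obtain ⟨w⟩ := (zdGraph_reachable q₀ z).mono zdGraph_le_zdStarGraph
      obtain ⟨v, -, hv, u, hu, huv⟩ := exists_farRight_adj_of_walk w
        (fun h => h.not_mem (Finset.mem_coe.2 hq₀)) hzfar
      exact ⟨v, hv, u, hu, huv⟩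
    -- (D3) connectivity inside `D`
    have hDconn : ∀ d ∈ D, ∀ t ∈ D, ∃ w : zdStarGraph.Walk d t, ∀ z ∈ w.support, z ∈ D := by
      rintro d ⟨hdfar, qd, hqd, hqdd⟩ t ⟨htfar, qt, hqt, hqtt⟩
      obtain ⟨P₁, hP₁⟩ := exists_walk_of_farRight Q hdfar htfar
      obtain ⟨w, hw⟩ := exists_starWalk_starBoundary Q hQconn (fun h => hdfar.not_mem (Finset.mem_coe.2 h))
        ⟨qd, hqd, hqdd.symm⟩ ⟨qt, hqt, hqtt.symm⟩ P₁ hP₁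
      have hwfar := farRight_of_walk_avoiding w hdfar (fun v hv h => (hw v hv).1 (Finset.mem_coe.1 h))
      refine ⟨w, fun z hz => ⟨hwfar z hz, ?_⟩⟩
      obtain ⟨cc, hcc, hadj⟩ := (hw z hz).2
      exact ⟨cc, hcc, hadj.symm⟩
    -- (D4) terminal case: `D ∩ Λ ⊆ kSet (-s)`
    have hD4 : (∃ t ∈ D, t ∉ Λ ∨ t ∈ kSet Λ c (-s)) → ∀ d ∈ D, d ∈ Λ → d ∈ kSet Λ c (-s) := by
      rintro ⟨t, htD, ht⟩ d hdD hdΛ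
      obtain ⟨W, hW⟩ := hDconn d hdD t htD
      -- induction along `W`
      have key : ∀ {a b : Site 2} (W : zdStarGraph.Walk a b), (∀ z ∈ W.support, z ∈ D) → a ∈ Λ →
          (b ∉ Λ ∨ b ∈ kSet Λ c (-s)) → a ∈ kSet Λ c (-s) := by
        intro a b W
        induction W with
        | nil => intro _ ha hb; rcases hb with hb | hb; exact absurd ha hb; exact hb
        | @cons a a' b hadj W' ih =>
          intro hWD ha hb
          have haD : a ∈ D := hWD a (by simp)
          have ha'D : a' ∈ D := hWD a' (by simp)
          have hca : c a = -s := hDcol a haD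
          by_cases ha'Λ : a' ∈ Λ
          · have ha'K := ih (fun z hz => hWD z (by rw [Walk.support_cons]; exact List.mem_cons_of_mem _ hz)) ha'Λ hb
            refine mem_kSet_of_reachable ha'K ha hca (Adj.reachable ?_)
            rw [sGraph, siteOpenGraph_adj]
            exact ⟨hadj, ⟨hca, ha⟩, ⟨hDcol a' ha'D, ha'Λ⟩⟩
          · exact mem_kSet_of_adj ha hca ha'Λ (onSide_of_colour hcpos hcneg ha'Λ (hDcol a' ha'D)) hadj
      exact key W hW hdΛ ht
    by_cases hterm : ∃ t ∈ D, t ∉ Λ ∨ t ∈ kSet Λ c (-s)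
    · -- (D5) contradiction with `x ∈ xSet (-s)`
      have hDK := hD4 hterm
      obtain ⟨-, hxK, q, ⟨z, hzΛ, hzside, hqz⟩, hr⟩ := hX (-s)
      obtain ⟨W, hW⟩ := exists_starWalk_of_reachable hr ⟨hx, hxK⟩
      have hqΛ : q ∈ Λ := (hW q (Walk.end_mem_support W)).1
      have hqQ : q ∉ Q := by
        intro hqQ
        refine hQK q hqQ (mem_kSet_of_adj hqΛ (hQc q hqQ) hzΛ ?_ hqz)
        unfold OnSide at hzside ⊢
        have : ((-s : ℤˣ) : ℤ) = -(s : ℤ) := Units.val_neg s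
        rw [this] at hzside
        push Not at hzside
        nlinarith
      have hqfar : FarRight ↑Q q := (hfar_out z hzΛ Q hQΛ).of_adj hqz (fun h => hqQ (Finset.mem_coe.1 h))
      obtain ⟨v, hvW, hvfar, u, hu, huv⟩ := exists_farRight_adj_of_walk W hQx hqfar
      have hvD : v ∈ D := ⟨hvfar, u, hu, huv⟩
      exact (hW v hvW).2 (hDK v hvD (hW v hvW).1)
    · -- (D6) iterate with the `-s`-cluster of `D`
      push Not at hterm
      have hDΛ : ∀ t ∈ D, t ∈ Λ := fun t ht => (hterm t ht).1
      have hDK' : ∀ t ∈ D, t ∉ kSet Λ c (-s) := fun t ht => (hterm t ht).2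
      set Q' : Finset (Site 2) := Λ.filter fun p => c p = -s ∧ ∃ d, d ∈ D ∧ (sGraph Λ c (-s)).Reachable d p with hQ'
      have hmemQ' : ∀ p, p ∈ Q' ↔ p ∈ Λ ∧ c p = -s ∧ ∃ d, d ∈ D ∧ (sGraph Λ c (-s)).Reachable d p := fun p => by
        rw [hQ', Finset.mem_filter]
      have hDQ' : ∀ d ∈ D, d ∈ Q' := fun d hd => (hmemQ' d).2 ⟨hDΛ d hd, hDcol d hd, d, hd, Reachable.refl _⟩
      have hQ'Λ : Q' ⊆ Λ := Finset.filter_subset _ _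
      have hQ'c : ∀ q ∈ Q', c q = -s := fun q hq => ((hmemQ' q).1 hq).2.1
      obtain ⟨d₀, hd₀⟩ := hDne
      have hQ'ne : Q'.Nonempty := ⟨d₀, hDQ' d₀ hd₀⟩
      have hQ'cl : ∀ q ∈ Q', ∀ p ∈ Λ, c p = -s → zdStarGraph.Adj q p → p ∈ Q' := by
        intro q hq p hp hcp hqp
        obtain ⟨hqΛ, hcq, d, hd, hr⟩ := (hmemQ' q).1 hq
        refine (hmemQ' p).2 ⟨hp, hcp, d, hd, hr.trans (Adj.reachable ?_)⟩
        rw [sGraph, siteOpenGraph_adj]; exact ⟨hqp, ⟨hcq, hqΛ⟩, ⟨hcp, hp⟩⟩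
      -- walks inside `Q'`
      have hwalkQ' : ∀ {d p : Site 2}, d ∈ D → (sGraph Λ c (-s)).Reachable d p →
          ∃ w : zdStarGraph.Walk d p, ∀ z ∈ w.support, z ∈ Q' := by
        intro d p hd hr
        obtain ⟨P⟩ := hr
        refine ⟨P.mapLe (fun u v huv => ((siteOpenGraph_adj _ _ _ _).1 huv).1), fun z hz => ?_⟩
        rw [Walk.support_mapLe_eq_support] at hz
        have hzO := support_subset_of_siteOpenGraph_walk P ⟨hDcol d hd, hDΛ d hd⟩ z hz
        exact (hmemQ' z).2 ⟨hzO.2, hzO.1, d, hd, reachable_of_mem_support_open P hz⟩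
      have hQ'conn : ∀ a ∈ Q', ∀ b ∈ Q', ∃ w : zdStarGraph.Walk a b, ∀ z ∈ w.support, z ∈ Q' := by
        intro a ha b hb
        obtain ⟨-, -, d₁, hd₁, hr₁⟩ := (hmemQ' a).1 ha
        obtain ⟨-, -, d₂, hd₂, hr₂⟩ := (hmemQ' b).1 hb
        obtain ⟨w₁, hw₁⟩ := hwalkQ' hd₁ hr₁
        obtain ⟨w₂, hw₂⟩ := hwalkQ' hd₂ hr₂
        obtain ⟨w₁₂, hw₁₂⟩ := hDconn d₁ hd₁ d₂ hd₂
        refine ⟨w₁.reverse.append (w₁₂.append w₂), fun z hz => ?_⟩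
        rw [Walk.mem_support_append_iff, Walk.mem_support_append_iff, Walk.support_reverse, List.mem_reverse] at hz
        rcases hz with hz | hz | hz
        · exact hw₁ z hz
        · exact hDQ' z (hw₁₂ z hz)
        · exact hw₂ z hz
      have hQ'K : ∀ q ∈ Q', q ∉ kSet Λ c (-s) := by
        intro q hq hqK
        obtain ⟨-, -, d, hd, hr⟩ := (hmemQ' q).1 hq
        exact hDK' d hd (mem_kSet_of_reachable hqK (hDΛ d hd) (hDcol d hd) hr)
      -- every far walk avoiding `Q'` avoids `Q`
      have havoid : ∀ {a b : Site 2} (W : zdStarGraph.Walk a b), (∀ z ∈ W.support, z ∉ Q') →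
          FarRight ↑Q b → ∀ z ∈ W.support, z ∉ Q := by
        intro a b W hW hb z hz hzQ
        obtain ⟨v, hv, hvfar, u, hu, huv⟩ := exists_farRight_adj_of_walk (W.dropUntil z hz)
          (fun h => h.not_mem (Finset.mem_coe.2 hzQ)) hb
        exact hW v (Walk.support_dropUntil_subset_support _ _ hv) (hDQ' v ⟨hvfar, u, hu, huv⟩)
      have hQ'x : ¬ FarRight ↑Q' x := by
        intro hxfar
        obtain ⟨w, hw, W, hW⟩ := hxfar M
        have hwΛ : w ∉ Λ := fun h => by have := hM w h; omega
        have hwfar : FarRight ↑Q w := hfar_out w hwΛ Q hQΛ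
        exact havoid W hW hwfar x (Walk.start_mem_support W) |> fun h => hQx (by
          obtain ⟨v, hv, hvfar, u, hu, huv⟩ := exists_farRight_adj_of_walk W hQx hwfar
          exact absurd (hDQ' v ⟨hvfar, u, hu, huv⟩) (hW v hv))
      -- the measure decreases
      have hsub : Λ.filter (fun v => FarRight ↑Q' v) ⊆ Λ.filter (fun v => FarRight ↑Q v) := by
        intro v hv
        rw [Finset.mem_filter] at hv ⊢
        refine ⟨hv.1, fun M' => ?_⟩
        obtain ⟨w, hw, W, hW⟩ := hv.2 (max M' M)
        have hwΛ : w ∉ Λ := fun h => by have := hM w h; omega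
        have hwfar : FarRight ↑Q w := hfar_out w hwΛ Q hQΛ
        exact ⟨w, (le_max_left _ _).trans hw, W, fun z hz h => havoid W hW hwfar z hz (Finset.mem_coe.1 h)⟩
      have hlt : #(Λ.filter fun v => FarRight ↑Q' v) < #(Λ.filter fun v => FarRight ↑Q v) := by
        refine Finset.card_lt_card (Finset.ssubset_iff_of_subset hsub |>.2 ⟨d₀, ?_, ?_⟩)
        · exact Finset.mem_filter.2 ⟨hDΛ d₀ hd₀, hd₀.1⟩
        · intro h
          exact (Finset.mem_filter.1 h).2.not_mem (Finset.mem_coe.2 (hDQ' d₀ hd₀))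
      exact IH (-s) Q' hlt hQ'Λ hQ'c hQ'ne hQ'cl hQ'conn hQ'K hQ'x
  -- the initial cluster and the induction on the measure
  set s₀ := c x with hs₀
  set Q₀ : Finset (Site 2) := Λ.filter fun q => c q = s₀ ∧ (sGraph Λ c s₀).Reachable x q with hQ₀
  have hmemQ₀ : ∀ q, q ∈ Q₀ ↔ q ∈ Λ ∧ c q = s₀ ∧ (sGraph Λ c s₀).Reachable x q := fun q => by
    rw [hQ₀, Finset.mem_filter]
  have hxQ₀ : x ∈ Q₀ := (hmemQ₀ x).2 ⟨hx, rfl, Reachable.refl _⟩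
  suffices main : ∀ (n : ℕ) (s : ℤˣ) (Q : Finset (Site 2)), #(Λ.filter fun v => FarRight ↑Q v) ≤ n →
      Q ⊆ Λ → (∀ q ∈ Q, c q = s) → Q.Nonempty →
      (∀ q ∈ Q, ∀ p ∈ Λ, c p = s → zdStarGraph.Adj q p → p ∈ Q) →
      (∀ a ∈ Q, ∀ b ∈ Q, ∃ w : zdStarGraph.Walk a b, ∀ z ∈ w.support, z ∈ Q) →
      (∀ q ∈ Q, q ∉ kSet Λ c s) → ¬ FarRight ↑Q x → False by
    refine main _ s₀ Q₀ le_rfl (Finset.filter_subset _ _) (fun q hq => ((hmemQ₀ q).1 hq).2.1) ⟨x, hxQ₀⟩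
      (fun q hq p hp hcp hqp => ?_) (fun a ha b hb => ?_) (fun q hq hqK => ?_) (fun h => h.not_mem (Finset.mem_coe.2 hxQ₀))
    · obtain ⟨hqΛ, hcq, hr⟩ := (hmemQ₀ q).1 hq
      refine (hmemQ₀ p).2 ⟨hp, hcp, hr.trans (Adj.reachable ?_)⟩
      rw [sGraph, siteOpenGraph_adj]; exact ⟨hqp, ⟨hcq, hqΛ⟩, ⟨hcp, hp⟩⟩
    · obtain ⟨-, -, hra⟩ := (hmemQ₀ a).1 ha
      obtain ⟨-, -, hrb⟩ := (hmemQ₀ b).1 hb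
      obtain ⟨P⟩ := hra.symm.trans hrb
      refine ⟨P.mapLe (fun u v huv => ((siteOpenGraph_adj _ _ _ _).1 huv).1), fun z hz => ?_⟩
      rw [Walk.support_mapLe_eq_support] at hz
      have haO : a ∈ {v | c v = s₀} ∩ (↑Λ : Set (Site 2)) := ⟨((hmemQ₀ a).1 ha).2.1, ((hmemQ₀ a).1 ha).1⟩
      have hzO := support_subset_of_siteOpenGraph_walk P haO z hz
      exact (hmemQ₀ z).2 ⟨hzO.2, hzO.1, hra.trans (reachable_of_mem_support_open P hz)⟩
    · obtain ⟨-, -, hr⟩ := (hmemQ₀ q).1 hq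
      exact hK s₀ (mem_kSet_of_reachable hqK hx rfl hr)
  intro n
  induction n with
  | zero =>
    intro s Q hcard hQΛ hQc hQne hQcl hQconn hQK hQx
    exact step s Q hQΛ hQc hQne hQcl hQconn hQK hQx fun s' Q' hlt => absurd hlt (by omega)
  | succ n ih =>
    intro s Q hcard hQΛ hQc hQne hQcl hQconn hQK hQx
    exact step s Q hQΛ hQc hQne hQcl hQconn hQK hQx fun s' Q' hlt => ih s' Q' (by omega)

end Onion

end Literature.Probability.Percolation
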